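import Mathlib
import HarnessLib
import Summits.AtomisticToContinuum.Crystallization.Theorems.FrustratedLawDichotomyAperiodicFrustratedLawGapErgodicLazyOperator
import Summits.AtomisticToContinuum.Crystallization.Theorems.FrustratedLawDichotomyAperiodicFrustratedLawGapErgodicInvariantMod

/-!
# Ergodic reduction for the crux `AperiodicFrustratedLawGap` — the weighted Campbell probability space

Route `FrustratedLawDichotomy`, crux `AperiodicFrustratedLawGap` (item `stmt-AtomisticToContinuum-27623`),
registered stub `stub_ergodicReduction` (skeleton `dd3251ad731e`); fifth brick of step D5 (`hErg`), see the
item's evidence `D5-PLAN.md` ("Refinement of D5c").  The lazy re-rooting operator is realised as `E† ∘ U ∘ E` on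
the Hilbert space `L²(π)` of the WEIGHTED CAMPBELL MEASURE `π = (ν ⊗ₘ κ₀).withDensity W`,
`W(S, y) = w(y) + (1 − Σ_{z∈S} w(z)) · 1[y = 0]` (the lazy mass sits on the root, a fixed point of the
re-rooting involution `Θ`).  This file proves the two measure-theoretic inputs of that construction:

* `campbellWeight_reroot` — `W ∘ Θ = W` on the incidence set (`w` even, `S − 0 = S`);
* `lintegral_campbellWeight_eq_one` — every fibre has `W`-mass one: `Σ_{y∈S} W(S,y) = 1` (when `Σ_{y∈S} w(y) ≤ 1`);
* `map_reroot_withDensity_campbellWeight` — `π` is invariant under `Θ`;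
* `map_fst_withDensity_campbellWeight` — the first marginal of `π` is `ν` (so `f ↦ f ∘ p₁` is an isometry
  `L²(ν) → L²(π)`).

`[folklore]`.
-/

noncomputable section

namespace Summit.AtomisticToContinuum.Crystallization.Theorems.FrustratedLawDichotomyErgodicReduction

open MeasureTheory Set Filter ProbabilityTheory
open scoped ENNReal Classical
open Literature.Probability.Process (LocalConfig)
open Literature.Probability.Process.LocalConfig (RootedHardCoreConfig toMeasure_def measurable_toMeasure)
open Summit.AtomisticToContinuum.Crystallization.Theorems.BenjaminiSchrammLimit (isSFiniteKernel_toMeasure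
  measurable_reroot isClosed_incidence)

variable {δ : ℝ}

/-- The root carries unit mass in every rooted hard-core configuration: `count|S {0} = 1`. [folklore] -/
theorem toMeasure_singleton_zero (S : RootedHardCoreConfig (EuclideanSpace ℝ (Fin 3)) δ) :
    ((S.1 : LocalConfig (EuclideanSpace ℝ (Fin 3))).toMeasure) {0} = 1 := by
  rw [toMeasure_def, Measure.restrict_apply (measurableSet_singleton 0),
    inter_eq_left.2 (singleton_subset_iff.2 S.2.1), Measure.count_singleton]

/-- **Every fibre of the weighted Campbell measure has mass one**: for a weight `w` of mass `Σ_{z∈S} w(z) ≤ 1`,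
`Σ_{y ∈ S} (w(y) + (1 − Σ_z w(z)) 1[y = 0]) = 1`. [folklore] -/
theorem lintegral_campbellWeight_eq_one {w : EuclideanSpace ℝ (Fin 3) → ℝ≥0∞} (hw : Measurable w)
    (S : RootedHardCoreConfig (EuclideanSpace ℝ (Fin 3)) δ)
    (hS : ∫⁻ y, w y ∂((S.1 : LocalConfig (EuclideanSpace ℝ (Fin 3))).toMeasure) ≤ 1) :
    ∫⁻ y, (w y + (1 - ∫⁻ z, w z ∂((S.1 : LocalConfig (EuclideanSpace ℝ (Fin 3))).toMeasure)) *
        ({(0 : EuclideanSpace ℝ (Fin 3))} : Set (EuclideanSpace ℝ (Fin 3))).indicator (fun _ => (1 : ℝ≥0∞)) y)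
      ∂((S.1 : LocalConfig (EuclideanSpace ℝ (Fin 3))).toMeasure) = 1 := by
  rw [lintegral_add_left hw, lintegral_const_mul _ ((measurable_const.indicator (measurableSet_singleton 0))),
    lintegral_indicator (measurableSet_singleton 0), setLIntegral_const, toMeasure_singleton_zero, one_mul,
    mul_one]
  exact add_tsub_cancel_of_le hS

/-- **The Campbell weight is invariant under re-rooting** on the incidence set: for `w` even and `y ∈ S`,
`W(Θ(S, y)) = W(S, y)`, where `W(S, y) = w(y) + (1 − Σ_{z∈S} w(z)) 1[y = 0]` and `Θ(S, y) = (S − y, −y)` (for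
`y = 0` the configuration is unchanged, `reroot_zero`; for `y ≠ 0` both indicator terms vanish). [folklore] -/
theorem campbellWeight_reroot {w : EuclideanSpace ℝ (Fin 3) → ℝ≥0∞} (hws : ∀ y, w (-y) = w y)
    (S : RootedHardCoreConfig (EuclideanSpace ℝ (Fin 3)) δ) (y : EuclideanSpace ℝ (Fin 3))
    (hy : y ∈ ((S.1 : LocalConfig (EuclideanSpace ℝ (Fin 3))) : Set (EuclideanSpace ℝ (Fin 3)))) :
    w (-y) + (1 - ∫⁻ z, w z ∂(((S.reroot y hy).1 : LocalConfig (EuclideanSpace ℝ (Fin 3))).toMeasure)) *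
        ({(0 : EuclideanSpace ℝ (Fin 3))} : Set (EuclideanSpace ℝ (Fin 3))).indicator (fun _ => (1 : ℝ≥0∞)) (-y) =
      w y + (1 - ∫⁻ z, w z ∂((S.1 : LocalConfig (EuclideanSpace ℝ (Fin 3))).toMeasure)) *
        ({(0 : EuclideanSpace ℝ (Fin 3))} : Set (EuclideanSpace ℝ (Fin 3))).indicator (fun _ => (1 : ℝ≥0∞)) y := by
  by_cases h0 : y = 0
  · subst h0
    rw [reroot_zero]
    simp
  · have h0' : -y ≠ 0 := neg_ne_zero.2 h0
    rw [hws, indicator_of_notMem (by simpa using h0'), indicator_of_notMem (by simpa using h0), mul_zero,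
      mul_zero]

/-- **The weighted Campbell measure is invariant under re-rooting.**  For a law `ν` on rooted `δ`-hard-core
configurations (`δ > 0`) with Campbell measure invariant under `Θ` and a measurable even weight `w`, the
measure `π = (ν ⊗ₘ κ₀).withDensity W`, `W(S,y) = w(y) + (1 − Σ_{z∈S} w(z)) 1[y=0]`, satisfies `π.map Θ = π`.
[folklore] -/
theorem map_reroot_withDensity_campbellWeight [Fact (0 < δ)]
    {ν : Measure (RootedHardCoreConfig (EuclideanSpace ℝ (Fin 3)) δ)} [SFinite ν]
    (hinv : haveI := isSFiniteKernel_toMeasure (E := EuclideanSpace ℝ (Fin 3)) (δ := δ)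
      (ν ⊗ₘ (⟨fun S : RootedHardCoreConfig (EuclideanSpace ℝ (Fin 3)) δ =>
        (S.1 : LocalConfig (EuclideanSpace ℝ (Fin 3))).toMeasure,
        measurable_toMeasure (Fact.out : 0 < δ)⟩ :
        Kernel (RootedHardCoreConfig (EuclideanSpace ℝ (Fin 3)) δ) (EuclideanSpace ℝ (Fin 3)))).map
      (fun p : RootedHardCoreConfig (EuclideanSpace ℝ (Fin 3)) δ × EuclideanSpace ℝ (Fin 3) =>
        ((if h : p.2 ∈ ((p.1.1 : LocalConfig (EuclideanSpace ℝ (Fin 3))) : Set (EuclideanSpace ℝ (Fin 3)))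
          then p.1.reroot p.2 h else p.1 : RootedHardCoreConfig (EuclideanSpace ℝ (Fin 3)) δ), -p.2)) =
      ν ⊗ₘ (⟨fun S : RootedHardCoreConfig (EuclideanSpace ℝ (Fin 3)) δ =>
        (S.1 : LocalConfig (EuclideanSpace ℝ (Fin 3))).toMeasure,
        measurable_toMeasure (Fact.out : 0 < δ)⟩ :
        Kernel (RootedHardCoreConfig (EuclideanSpace ℝ (Fin 3)) δ) (EuclideanSpace ℝ (Fin 3))))
    {w : EuclideanSpace ℝ (Fin 3) → ℝ≥0∞} (hw : Measurable w) (hws : ∀ y, w (-y) = w y) :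
    haveI := isSFiniteKernel_toMeasure (E := EuclideanSpace ℝ (Fin 3)) (δ := δ)
    ((ν ⊗ₘ (⟨fun S : RootedHardCoreConfig (EuclideanSpace ℝ (Fin 3)) δ =>
        (S.1 : LocalConfig (EuclideanSpace ℝ (Fin 3))).toMeasure,
        measurable_toMeasure (Fact.out : 0 < δ)⟩ :
        Kernel (RootedHardCoreConfig (EuclideanSpace ℝ (Fin 3)) δ) (EuclideanSpace ℝ (Fin 3)))).withDensity
      (fun p : RootedHardCoreConfig (EuclideanSpace ℝ (Fin 3)) δ × EuclideanSpace ℝ (Fin 3) =>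
        w p.2 + (1 - ∫⁻ z, w z ∂((p.1.1 : LocalConfig (EuclideanSpace ℝ (Fin 3))).toMeasure)) *
          ({(0 : EuclideanSpace ℝ (Fin 3))} : Set (EuclideanSpace ℝ (Fin 3))).indicator
            (fun _ => (1 : ℝ≥0∞)) p.2)).map
      (fun p : RootedHardCoreConfig (EuclideanSpace ℝ (Fin 3)) δ × EuclideanSpace ℝ (Fin 3) =>
        ((if h : p.2 ∈ ((p.1.1 : LocalConfig (EuclideanSpace ℝ (Fin 3))) : Set (EuclideanSpace ℝ (Fin 3)))
          then p.1.reroot p.2 h else p.1 : RootedHardCoreConfig (EuclideanSpace ℝ (Fin 3)) δ), -p.2)) =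
    (ν ⊗ₘ (⟨fun S : RootedHardCoreConfig (EuclideanSpace ℝ (Fin 3)) δ =>
        (S.1 : LocalConfig (EuclideanSpace ℝ (Fin 3))).toMeasure,
        measurable_toMeasure (Fact.out : 0 < δ)⟩ :
        Kernel (RootedHardCoreConfig (EuclideanSpace ℝ (Fin 3)) δ) (EuclideanSpace ℝ (Fin 3)))).withDensity
      (fun p : RootedHardCoreConfig (EuclideanSpace ℝ (Fin 3)) δ × EuclideanSpace ℝ (Fin 3) =>
        w p.2 + (1 - ∫⁻ z, w z ∂((p.1.1 : LocalConfig (EuclideanSpace ℝ (Fin 3))).toMeasure)) *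
          ({(0 : EuclideanSpace ℝ (Fin 3))} : Set (EuclideanSpace ℝ (Fin 3))).indicator
            (fun _ => (1 : ℝ≥0∞)) p.2) := by
  haveI := isSFiniteKernel_toMeasure (E := EuclideanSpace ℝ (Fin 3)) (δ := δ)
  have hδ : 0 < δ := Fact.out
  have hΘ : Measurable (fun p : RootedHardCoreConfig (EuclideanSpace ℝ (Fin 3)) δ × EuclideanSpace ℝ (Fin 3) =>
      ((if h : p.2 ∈ ((p.1.1 : LocalConfig (EuclideanSpace ℝ (Fin 3))) : Set (EuclideanSpace ℝ (Fin 3)))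
        then p.1.reroot p.2 h else p.1 : RootedHardCoreConfig (EuclideanSpace ℝ (Fin 3)) δ), -p.2)) :=
    measurable_reroot hδ
  have hmem := ae_snd_mem_compProd (δ := δ) ν
  set Θ' : RootedHardCoreConfig (EuclideanSpace ℝ (Fin 3)) δ × EuclideanSpace ℝ (Fin 3) →
      RootedHardCoreConfig (EuclideanSpace ℝ (Fin 3)) δ × EuclideanSpace ℝ (Fin 3) :=
    fun p => ((if h : p.2 ∈ ((p.1.1 : LocalConfig (EuclideanSpace ℝ (Fin 3))) : Set (EuclideanSpace ℝ (Fin 3)))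
      then p.1.reroot p.2 h else p.1 : RootedHardCoreConfig (EuclideanSpace ℝ (Fin 3)) δ), -p.2) with hΘ'_def
  set W : RootedHardCoreConfig (EuclideanSpace ℝ (Fin 3)) δ × EuclideanSpace ℝ (Fin 3) → ℝ≥0∞ :=
    fun p => w p.2 + (1 - ∫⁻ z, w z ∂((p.1.1 : LocalConfig (EuclideanSpace ℝ (Fin 3))).toMeasure)) *
      ({(0 : EuclideanSpace ℝ (Fin 3))} : Set (EuclideanSpace ℝ (Fin 3))).indicator (fun _ => (1 : ℝ≥0∞)) p.2
    with hW_def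
  have hW : Measurable W :=
    (hw.comp measurable_snd).add ((measurable_const.sub ((measurable_lintegral_weight hw).comp measurable_fst)).mul
      ((measurable_const.indicator (measurableSet_singleton 0)).comp measurable_snd))
  -- `W ∘ Θ = W` almost everywhere for the Campbell measure
  have hWΘ : ∀ᵐ p ∂(ν ⊗ₘ (⟨fun S : RootedHardCoreConfig (EuclideanSpace ℝ (Fin 3)) δ =>
        (S.1 : LocalConfig (EuclideanSpace ℝ (Fin 3))).toMeasure,
        measurable_toMeasure (Fact.out : 0 < δ)⟩ :
        Kernel (RootedHardCoreConfig (EuclideanSpace ℝ (Fin 3)) δ) (EuclideanSpace ℝ (Fin 3)))),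
      W (Θ' p) = W p := by
    filter_upwards [hmem] with p hp
    obtain ⟨S, y⟩ := p
    have hy : y ∈ ((S.1 : LocalConfig (EuclideanSpace ℝ (Fin 3))) : Set (EuclideanSpace ℝ (Fin 3))) := hp
    simp only [hW_def, hΘ'_def, dif_pos hy]
    exact campbellWeight_reroot hws S y hy
  refine Measure.ext fun C hC => ?_
  rw [Measure.map_apply hΘ hC, withDensity_apply _ (hΘ hC), withDensity_apply _ hC,
    ← lintegral_indicator (hΘ hC), ← lintegral_indicator hC]
  -- `∫ 1_{Θ⁻¹ C} W = ∫ (1_C W) ∘ Θ = ∫ 1_C W d(map Θ) = ∫ 1_C W`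
  have h1 : ∫⁻ p, (Θ' ⁻¹' C).indicator W p ∂(ν ⊗ₘ (⟨fun S : RootedHardCoreConfig (EuclideanSpace ℝ (Fin 3)) δ =>
        (S.1 : LocalConfig (EuclideanSpace ℝ (Fin 3))).toMeasure,
        measurable_toMeasure (Fact.out : 0 < δ)⟩ :
        Kernel (RootedHardCoreConfig (EuclideanSpace ℝ (Fin 3)) δ) (EuclideanSpace ℝ (Fin 3)))) =
      ∫⁻ p, C.indicator W (Θ' p) ∂(ν ⊗ₘ (⟨fun S : RootedHardCoreConfig (EuclideanSpace ℝ (Fin 3)) δ =>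
        (S.1 : LocalConfig (EuclideanSpace ℝ (Fin 3))).toMeasure,
        measurable_toMeasure (Fact.out : 0 < δ)⟩ :
        Kernel (RootedHardCoreConfig (EuclideanSpace ℝ (Fin 3)) δ) (EuclideanSpace ℝ (Fin 3)))) := by
    refine lintegral_congr_ae (hWΘ.mono fun p hp => ?_)
    simp only [Set.indicator_apply, mem_preimage, hp]
  rw [h1, ← lintegral_map ((hW.indicator hC)) hΘ, hinv]

/-- **The first marginal of the weighted Campbell measure is the law itself**: for `w` with
`Σ_{y∈S} w(y) ≤ 1` on every configuration, `((ν ⊗ₘ κ₀).withDensity W).map Prod.fst = ν`. [folklore] -/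
theorem map_fst_withDensity_campbellWeight [Fact (0 < δ)]
    (ν : Measure (RootedHardCoreConfig (EuclideanSpace ℝ (Fin 3)) δ)) [SFinite ν]
    {w : EuclideanSpace ℝ (Fin 3) → ℝ≥0∞} (hw : Measurable w)
    (hw1 : ∀ S : RootedHardCoreConfig (EuclideanSpace ℝ (Fin 3)) δ,
      ∫⁻ y, w y ∂((S.1 : LocalConfig (EuclideanSpace ℝ (Fin 3))).toMeasure) ≤ 1) :
    haveI := isSFiniteKernel_toMeasure (E := EuclideanSpace ℝ (Fin 3)) (δ := δ)
    ((ν ⊗ₘ (⟨fun S : RootedHardCoreConfig (EuclideanSpace ℝ (Fin 3)) δ =>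
        (S.1 : LocalConfig (EuclideanSpace ℝ (Fin 3))).toMeasure,
        measurable_toMeasure (Fact.out : 0 < δ)⟩ :
        Kernel (RootedHardCoreConfig (EuclideanSpace ℝ (Fin 3)) δ) (EuclideanSpace ℝ (Fin 3)))).withDensity
      (fun p : RootedHardCoreConfig (EuclideanSpace ℝ (Fin 3)) δ × EuclideanSpace ℝ (Fin 3) =>
        w p.2 + (1 - ∫⁻ z, w z ∂((p.1.1 : LocalConfig (EuclideanSpace ℝ (Fin 3))).toMeasure)) *
          ({(0 : EuclideanSpace ℝ (Fin 3))} : Set (EuclideanSpace ℝ (Fin 3))).indicator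
            (fun _ => (1 : ℝ≥0∞)) p.2)).map Prod.fst = ν := by
  haveI := isSFiniteKernel_toMeasure (E := EuclideanSpace ℝ (Fin 3)) (δ := δ)
  set W : RootedHardCoreConfig (EuclideanSpace ℝ (Fin 3)) δ × EuclideanSpace ℝ (Fin 3) → ℝ≥0∞ :=
    fun p => w p.2 + (1 - ∫⁻ z, w z ∂((p.1.1 : LocalConfig (EuclideanSpace ℝ (Fin 3))).toMeasure)) *
      ({(0 : EuclideanSpace ℝ (Fin 3))} : Set (EuclideanSpace ℝ (Fin 3))).indicator (fun _ => (1 : ℝ≥0∞)) p.2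
    with hW_def
  have hW : Measurable W :=
    (hw.comp measurable_snd).add ((measurable_const.sub ((measurable_lintegral_weight hw).comp measurable_fst)).mul
      ((measurable_const.indicator (measurableSet_singleton 0)).comp measurable_snd))
  refine Measure.ext fun A hA => ?_
  rw [Measure.map_apply measurable_fst hA, withDensity_apply _ (measurable_fst hA),
    ← lintegral_indicator (measurable_fst hA), Measure.lintegral_compProd ((hW.indicator (measurable_fst hA)))]
  have h : ∀ S : RootedHardCoreConfig (EuclideanSpace ℝ (Fin 3)) δ,
      ∫⁻ y, (Prod.fst ⁻¹' A).indicator W (S, y) ∂((S.1 : LocalConfig (EuclideanSpace ℝ (Fin 3))).toMeasure) =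
        A.indicator 1 S := by
    intro S
    by_cases hS : S ∈ A
    · simp only [Set.indicator_apply, mem_preimage, hS, if_true, Pi.one_apply]
      exact lintegral_campbellWeight_eq_one hw S (hw1 S)
    · simp only [Set.indicator_apply, mem_preimage, hS, if_false, lintegral_zero, Pi.one_apply]
  simp_rw [Kernel.coe_mk, h]
  rw [lintegral_indicator_one hA]

end Summit.AtomisticToContinuum.Crystallization.Theorems.FrustratedLawDichotomyErgodicReduction

end
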